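import Literature.Geometry.Riemannian.MeanConvexFermiFrameSum
import Literature.Geometry.Riemannian.MeanConvexFramePerturbation
import Literature.Geometry.Riemannian.MeanConvexHelpTerm

/-!
# Mean convexity of the junction hypersurface `{Φ(‖Y‖, t) = 0}`

Topic `Geometry/Riemannian` (fact seat
`provefact-Literature.Geometry.Riemannian.LawsonMichelsohn1984_surrounding`).  Everything here
is **proved**; no definitions.

The pointwise heart of Lawson–Michelsohn's handle theorem (Thm. 3.1): at a zero `x` of
`G' = Φ(‖Y‖, t)` — `Y` the normalised normal coordinate of the core, `t` the height over the
mean-convex boundary, `Φ` the planar junction profile — the differential of `G'` is nonzero and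
the tangent-frame sums of `D²G'` are positive, provided the seven scalars of the Fermi data are
`δ`-flat with `δ` small (`MeanConvexFermiData`), the second derivatives of the data are bounded,
and the planar profile satisfies at `(‖Y x‖, t x)` either the **dominance** alternative
(`Q ≥ c_dom · (scales of Φ)`, `Q ≥ M` with `M` above the junk terms) or the **far-zone**
alternative (`Φ_t = 1`, `Φ_r ≤ tan α` tiny, `Q ≥ -2h`) backed by the help term `H₀` of the
boundary (`MeanConvexFermiHeight`):

`∑ᵢ D²G'(vᵢ, vᵢ) = [Q + O(δ)] + Φ_r ∑⟨ŷ, D²Y(vᵢ,vᵢ)⟩ + Φ_t ∑ D²t(vᵢ, vᵢ) > 0`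
(`MeanConvexFermiFrameSum.frameSum_fermiFun`, `MeanConvexFramePerturbation`, `MeanConvexHelpTerm`).

* `junction_fderiv_ne_zero` — regularity: `‖∇G'‖² ≥ (Φ_r² + Φ_t²)/2`;
* `junction_frameSum_pos` — positivity of the tangent-frame sums.

## References

* H. B. Lawson, Jr., M.-L. Michelsohn, *Embedding and surrounding with positive mean curvature*,
  Invent. Math. 77 (1984), Thm. 3.1. [LawsonMichelsohn1984]
-/

noncomputable section

open Set Function Filter Module
open scoped Topology RealInnerProductSpace

namespace Literature.Geometry.Riemannian

variable {E F : Type*} [NormedAddCommGroup E] [InnerProductSpace ℝ E] [FiniteDimensional ℝ E]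
  [NormedAddCommGroup F] [InnerProductSpace ℝ F] [CompleteSpace F] {m : ℕ}

omit [FiniteDimensional ℝ E] [CompleteSpace F] in
/-- Inner products with `g = φr • a + φt • b` and the norms of `g`, `L g` in the seven scalars.
[folklore] -/
theorem inner_norm_combination (L : E →L[ℝ] F) (a b : E) (φr φt : ℝ) :
    ⟪a, φr • a + φt • b⟫ = φr * ‖a‖ ^ 2 + φt * ⟪a, b⟫ ∧
    ⟪b, φr • a + φt • b⟫ = φr * ⟪a, b⟫ + φt * ‖b‖ ^ 2 ∧
    ‖φr • a + φt • b‖ ^ 2 = φr ^ 2 * ‖a‖ ^ 2 + 2 * φr * φt * ⟪a, b⟫ + φt ^ 2 * ‖b‖ ^ 2 ∧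
    ‖L (φr • a + φt • b)‖ ^ 2 =
      φr ^ 2 * ‖L a‖ ^ 2 + 2 * φr * φt * ⟪L a, L b⟫ + φt ^ 2 * ‖L b‖ ^ 2 := by
  refine ⟨?_, ?_, ?_, ?_⟩
  · rw [inner_add_right, real_inner_smul_right, real_inner_smul_right, real_inner_self_eq_norm_sq]
  · rw [inner_add_right, real_inner_smul_right, real_inner_smul_right, real_inner_self_eq_norm_sq,
      real_inner_comm]
  · rw [← real_inner_self_eq_norm_sq, inner_add_left, inner_add_right, inner_add_right,
      real_inner_smul_left, real_inner_smul_left, real_inner_smul_right, real_inner_smul_right,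
      real_inner_smul_left, real_inner_smul_right, real_inner_smul_right, real_inner_smul_left,
      real_inner_self_eq_norm_sq, real_inner_self_eq_norm_sq, real_inner_comm b a]
    ring
  · rw [map_add, map_smul, map_smul, ← real_inner_self_eq_norm_sq, inner_add_left, inner_add_right,
      inner_add_right, real_inner_smul_left, real_inner_smul_left, real_inner_smul_right,
      real_inner_smul_right, real_inner_smul_left, real_inner_smul_right, real_inner_smul_right,
      real_inner_smul_left, real_inner_self_eq_norm_sq, real_inner_self_eq_norm_sq,
      real_inner_comm (L b) (L a)]
    ring

omit [FiniteDimensional ℝ E] in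
/-- **Regularity of the junction function.**  If `|‖a‖² - 1|, |‖b‖² - 1|, |⟨a, b⟩| ≤ δ ≤ 1/4`
then `‖φr a + φt b‖² ≥ (φr² + φt²)/2`; in particular the gradient `Φ_r a + Φ_t b` of
`Φ(‖Y‖, t)` is nonzero as soon as `(Φ_r, Φ_t) ≠ 0`. [folklore] -/
theorem norm_sq_combination_ge {a b : E} {φr φt δ : ℝ} (hδ : δ ≤ 1 / 4) (h1 : |‖a‖ ^ 2 - 1| ≤ δ)
    (h2 : |‖b‖ ^ 2 - 1| ≤ δ) (h3 : |⟪a, b⟫| ≤ δ) :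
    (φr ^ 2 + φt ^ 2) / 2 ≤ ‖φr • a + φt • b‖ ^ 2 := by
  obtain ⟨-, -, hg, -⟩ := inner_norm_combination (0 : E →L[ℝ] E) a b φr φt
  rw [hg]
  have ha := (abs_le.1 h1).1
  have hb := (abs_le.1 h2).1
  have hδ0 : 0 ≤ δ := (abs_nonneg _).trans h3
  have h4 : -((φr ^ 2 + φt ^ 2) * δ) ≤ 2 * φr * φt * ⟪a, b⟫ := by
    have h6 : |2 * φr * φt * ⟪a, b⟫| ≤ (φr ^ 2 + φt ^ 2) * δ := by
      rw [show 2 * φr * φt * ⟪a, b⟫ = 2 * ((φr * φt) * ⟪a, b⟫) by ring, abs_mul, abs_two, abs_mul]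
      have h0 := two_mul_abs_mul_le φr φt
      have h7 : |φr * φt| * |⟪a, b⟫| ≤ |φr * φt| * δ := mul_le_mul_of_nonneg_left h3 (abs_nonneg _)
      nlinarith [abs_nonneg (φr * φt)]
    linarith [(abs_le.1 h6).1]
  nlinarith [mul_le_mul_of_nonneg_left ha (sq_nonneg φr), mul_le_mul_of_nonneg_left hb (sq_nonneg φt)]

set_option maxHeartbeats 1600000 in
/-- **Mean convexity and regularity of the junction hypersurface.**  See the module docstring.
The data at `x` are abbreviated by the equations `hL, ha, hb, hΦr, hΦt, hA, hBrt, hBtr, hC, hQ`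
(pass `rfl`). [cite: LawsonMichelsohn1984, Thm. 3.1] -/
theorem junction_frameSum_pos (hE : finrank ℝ E = m + 1) {Y : E → F} {t : E → ℝ}
    {Φ : ℝ × ℝ → ℝ} {x : E} (hY : ContDiffAt ℝ 2 Y x) (ht : ContDiffAt ℝ 2 t x) (hx : Y x ≠ 0)
    (hΦ : ContDiffAt ℝ 2 Φ (‖Y x‖, t x)) {ι : Type*} [Fintype ι] (bH : OrthonormalBasis ι ℝ E)
    {L : E →L[ℝ] F} {a b : E} {Φr Φt A Brt Btr C Q : ℝ} (hL : L = fderiv ℝ Y x)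
    (ha : a = L.adjoint (‖Y x‖⁻¹ • Y x))
    (hb : b = (InnerProductSpace.toDual ℝ E).symm (fderiv ℝ t x))
    (hΦr : Φr = fderiv ℝ Φ (‖Y x‖, t x) (1, 0)) (hΦt : Φt = fderiv ℝ Φ (‖Y x‖, t x) (0, 1))
    (hA : A = fderiv ℝ (fderiv ℝ Φ) (‖Y x‖, t x) (1, 0) (1, 0))
    (hBrt : Brt = fderiv ℝ (fderiv ℝ Φ) (‖Y x‖, t x) (1, 0) (0, 1))
    (hBtr : Btr = fderiv ℝ (fderiv ℝ Φ) (‖Y x‖, t x) (0, 1) (1, 0))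
    (hC : C = fderiv ℝ (fderiv ℝ Φ) (‖Y x‖, t x) (0, 1) (0, 1)) {k : ℝ}
    (hQ : Q = (A * Φt ^ 2 - (Brt + Btr) * Φr * Φt + C * Φr ^ 2) / (Φr ^ 2 + Φt ^ 2) +
      (k - 1) * Φr / ‖Y x‖)
    {δ c_dom M M_L M₂ h tα R₁ Abd H₀ : ℝ} (hδ0 : 0 ≤ δ) (hδ : δ ≤ 1 / 4) (hML : 0 ≤ M_L)
    (hM₂ : 0 ≤ M₂)
    (h1 : |‖a‖ ^ 2 - 1| ≤ δ) (h2 : |‖b‖ ^ 2 - 1| ≤ δ) (h3 : |⟪a, b⟫| ≤ δ)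
    (h4 : |∑ j, ‖L (stdOrthonormalBasis ℝ E j)‖ ^ 2 - k| ≤ δ) (h5 : |‖L a‖ ^ 2 - 1| ≤ δ)
    (h6 : |‖L b‖ ^ 2| ≤ δ) (h7 : |⟪L a, L b⟫| ≤ δ)
    (hD2Y : ‖fderiv ℝ (fderiv ℝ Y) x‖ ≤ M_L) (hD2t : ‖fderiv ℝ (fderiv ℝ t) x‖ ≤ M₂)
    (hΦr0 : 0 ≤ Φr) (hΦt0 : 0 ≤ Φt) (hne : Φr ≠ 0 ∨ Φt ≠ 0)
    (halt : (c_dom * (|A| + |Brt + Btr| + |C|) + c_dom * |Φr| / ‖Y x‖ ≤ Q ∧ M ≤ Q ∧ 0 < M ∧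
        40 * δ ≤ c_dom ∧ 0 < c_dom ∧ 4 * (m * (Φr * M_L + Φt * M₂)) ≤ M) ∨
      (Φt = 1 ∧ Φr ≤ tα ∧ |A| ≤ Abd ∧ Brt = 0 ∧ Btr = 0 ∧ C = 0 ∧ -(2 * h) ≤ Q ∧ R₁ ≤ ‖Y x‖ ∧
        0 < R₁ ∧ 1 / 2 ≤ ‖b‖ ∧
        H₀ ≤ ∑ j, fderiv ℝ (fderiv ℝ t) x (bH j) (bH j) - fderiv ℝ (fderiv ℝ t) x b b / ‖b‖ ^ 2 ∧
        2 * h + 20 * δ * Abd + 20 * δ * tα / R₁ + tα * (m * M_L) + 12 * M₂ * tα < H₀)) :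
    fderiv ℝ (fun z => Φ (‖Y z‖, t z)) x ≠ 0 ∧
    ∀ v : Fin m → E, Orthonormal ℝ v → (∀ i, fderiv ℝ (fun z => Φ (‖Y z‖, t z)) x (v i) = 0) →
      0 < ∑ i, iteratedFDeriv ℝ 2 (fun z => Φ (‖Y z‖, t z)) x ![v i, v i] := by
  haveI : CompleteSpace E := FiniteDimensional.complete ℝ E
  set r : ℝ := ‖Y x‖ with hr
  have hrpos : 0 < r := norm_pos_iff.2 hx
  set yh : F := r⁻¹ • Y x with hyh
  have hyh1 : ‖yh‖ = 1 := by rw [hyh, norm_smul, norm_inv, norm_norm, ← hr, inv_mul_cancel₀ hrpos.ne']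
  set G' : E → ℝ := fun z => Φ (‖Y z‖, t z) with hG'
  set g : E := Φr • a + Φt • b with hg
  -- ### the differential
  have hYd : DifferentiableAt ℝ Y x := hY.differentiableAt (by simp)
  have htd : DifferentiableAt ℝ t x := ht.differentiableAt (by simp)
  have hΦd : DifferentiableAt ℝ Φ (‖Y x‖, t x) := hΦ.differentiableAt (by simp)
  have hdG : ∀ u, fderiv ℝ G' x u = ⟪g, u⟫ := fun u => by
    rw [hG', fderiv_fermiFun_apply Φ Y t hYd htd hx hΦd u, ← hL, ← hr, ← hyh, ← ha, ← hb, ← hΦr, ← hΦt,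
      hg, inner_add_left, real_inner_smul_left, real_inner_smul_left]
  obtain ⟨hag, hbg, hgg, hLg⟩ := inner_norm_combination L a b Φr Φt
  have hgsq : (Φr ^ 2 + Φt ^ 2) / 2 ≤ ‖g‖ ^ 2 := norm_sq_combination_ge hδ h1 h2 h3
  have hD₀ : 0 < Φr ^ 2 + Φt ^ 2 := by
    rcases hne with hh | hh
    · have := sq_pos_of_ne_zero hh; linarith only [this, sq_nonneg Φt]
    · have := sq_pos_of_ne_zero hh; linarith only [this, sq_nonneg Φr]
  have hgne : g ≠ 0 := by
    intro h0; rw [h0, norm_zero] at hgsq; nlinarith only [hgsq, hD₀]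
  have hdGne : fderiv ℝ G' x ≠ 0 := by
    intro h0
    have := hdG g
    rw [h0, real_inner_self_eq_norm_sq] at this
    have h1' : ‖g‖ ^ 2 = 0 := by simpa using this.symm
    exact hgne (by rwa [sq_eq_zero_iff, norm_eq_zero] at h1')
  refine ⟨hdGne, fun v hv hvf => ?_⟩
  have hvg : ∀ i, ⟪v i, g⟫ = 0 := fun i => by rw [real_inner_comm, ← hdG]; exact hvf i
  -- ### the frame-sum identity, rewritten in the seven scalars
  have hFS := frameSum_fermiFun Φ Y t hE hY ht hx hΦ hdGne hv hvf
  rw [← hr] at hFS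
  rw [← hL, ← hyh, ← ha, ← hb, ← hΦr, ← hΦt, ← hA, ← hBrt, ← hBtr, ← hC] at hFS
  rw [hag, hbg, hgg, hLg] at hFS
  -- the scalar perturbation estimate
  have hS := abs_scalarFrameSum_sub_flat_le (A := A) (B := Brt + Btr) (C := C) (φr := Φr) (φt := Φt)
    (r := r) (k := k) (δ := δ) (n₁ := ‖a‖ ^ 2) (n₂ := ‖b‖ ^ 2) (n₃ := ⟪a, b⟫)
    (n₄ := ∑ j, ‖L (stdOrthonormalBasis ℝ E j)‖ ^ 2) (n₅ := ‖L a‖ ^ 2) (n₆ := ‖L b‖ ^ 2)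
    (n₇ := ⟪L a, L b⟫) hrpos hδ0 hδ hne h1 h2 h3 h4 h5 h6 h7
  rw [← hQ] at hS
  have hSle := (abs_le.1 hS).1
  -- ### the junk terms
  have hjunkY : ∀ i, |⟪yh, fderiv ℝ (fderiv ℝ Y) x (v i) (v i)⟫| ≤ M_L := fun i => by
    have hv1 : ‖v i‖ = 1 := hv.1 i
    calc |⟪yh, fderiv ℝ (fderiv ℝ Y) x (v i) (v i)⟫| ≤ ‖yh‖ * ‖fderiv ℝ (fderiv ℝ Y) x (v i) (v i)‖ :=
          abs_real_inner_le_norm _ _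
      _ ≤ 1 * (‖fderiv ℝ (fderiv ℝ Y) x‖ * ‖v i‖ * ‖v i‖) := by
          rw [hyh1]
          refine mul_le_mul_of_nonneg_left ?_ zero_le_one
          exact ((fderiv ℝ (fderiv ℝ Y) x (v i)).le_opNorm _).trans
            (mul_le_mul_of_nonneg_right ((fderiv ℝ (fderiv ℝ Y) x).le_opNorm _) (norm_nonneg _))
      _ ≤ M_L := by rw [hv1, mul_one, mul_one, one_mul]; exact hD2Y
  have hjunkt : ∀ u w : E, |fderiv ℝ (fderiv ℝ t) x u w| ≤ M₂ * ‖u‖ * ‖w‖ := fun u w => by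
    rw [← Real.norm_eq_abs]
    calc ‖fderiv ℝ (fderiv ℝ t) x u w‖ ≤ ‖fderiv ℝ (fderiv ℝ t) x u‖ * ‖w‖ := (fderiv ℝ (fderiv ℝ t) x u).le_opNorm w
      _ ≤ ‖fderiv ℝ (fderiv ℝ t) x‖ * ‖u‖ * ‖w‖ :=
          mul_le_mul_of_nonneg_right ((fderiv ℝ (fderiv ℝ t) x).le_opNorm u) (norm_nonneg _)
      _ ≤ M₂ * ‖u‖ * ‖w‖ := by gcongr
  have hjunkt1 : ∀ i, |fderiv ℝ (fderiv ℝ t) x (v i) (v i)| ≤ M₂ := fun i => by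
    have := hjunkt (v i) (v i); rw [hv.1 i, mul_one, mul_one] at this; exact this
  -- ### the two alternatives
  rcases halt with ⟨hdom, hMQ, hMpos, hδc, hcpos, hjunk⟩ |
    ⟨hΦt1', hΦrα, hAbd, hB1, hB2, hC0, hQh, hR₁r, hR₁, hbhalf, hhelp, hsmall⟩
  · -- dominance
    have hJ : -(m * (Φr * M_L + Φt * M₂)) ≤
        ∑ i, (Φr * ⟪yh, fderiv ℝ (fderiv ℝ Y) x (v i) (v i)⟫ + Φt * fderiv ℝ (fderiv ℝ t) x (v i) (v i)) := by
      have hterm : ∀ i, -(Φr * M_L + Φt * M₂) ≤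
          Φr * ⟪yh, fderiv ℝ (fderiv ℝ Y) x (v i) (v i)⟫ + Φt * fderiv ℝ (fderiv ℝ t) x (v i) (v i) := by
        intro i
        have hY' := (abs_le.1 (hjunkY i)).1
        have ht' := (abs_le.1 (hjunkt1 i)).1
        nlinarith only [hY', ht', hΦr0, hΦt0]
      have := Finset.sum_le_sum fun i (_ : i ∈ Finset.univ) => hterm i
      rw [Finset.sum_const, Finset.card_univ, Fintype.card_fin, nsmul_eq_mul] at this
      linarith only [this]
    -- `err ≤ Q/2`
    have herr : 20 * δ * (|A| + |Brt + Btr| + |C|) + 20 * δ * |Φr| / r ≤ Q / 2 := by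
      have h20 : 20 * δ ≤ c_dom / 2 := by linarith only [hδc]
      have hpos1 : 0 ≤ |A| + |Brt + Btr| + |C| := by positivity
      have hpos2 : 0 ≤ |Φr| / r := by positivity
      calc 20 * δ * (|A| + |Brt + Btr| + |C|) + 20 * δ * |Φr| / r
          = 20 * δ * (|A| + |Brt + Btr| + |C|) + 20 * δ * (|Φr| / r) := by ring
        _ ≤ c_dom / 2 * (|A| + |Brt + Btr| + |C|) + c_dom / 2 * (|Φr| / r) := by gcongr
        _ = (c_dom * (|A| + |Brt + Btr| + |C|) + c_dom * |Φr| / r) / 2 := by ring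
        _ ≤ Q / 2 := by linarith only [hdom]
    rw [hFS]
    linarith only [hSle, hJ, herr, hMQ, hjunk, hMpos]
  · -- far zone
    subst hB1; subst hB2; subst hC0
    have hΦt_one : Φt = 1 := hΦt1'
    -- `err ≤ 20 δ Abd + 20 δ tα / R₁`
    have herr : 20 * δ * (|A| + |(0 : ℝ) + 0| + |(0 : ℝ)|) + 20 * δ * |Φr| / r ≤
        20 * δ * Abd + 20 * δ * tα / R₁ := by
      rw [add_zero, abs_zero, add_zero, add_zero, abs_of_nonneg hΦr0]
      have h1' : 20 * δ * |A| ≤ 20 * δ * Abd := by gcongr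
      have h2' : 20 * δ * Φr / r ≤ 20 * δ * tα / R₁ := by
        rw [mul_div_assoc, mul_div_assoc]
        refine mul_le_mul_of_nonneg_left ?_ (by positivity)
        calc Φr / r ≤ tα / r := div_le_div_of_nonneg_right hΦrα hrpos.le
          _ ≤ tα / R₁ := div_le_div_of_nonneg_left (hΦr0.trans hΦrα) hR₁ hR₁r
      linarith only [h1', h2']
    -- the `Y`-junk
    have hJY : -(tα * (m * M_L)) ≤ ∑ i, Φr * ⟪yh, fderiv ℝ (fderiv ℝ Y) x (v i) (v i)⟫ := by
      have hterm : ∀ i, -(Φr * M_L) ≤ Φr * ⟪yh, fderiv ℝ (fderiv ℝ Y) x (v i) (v i)⟫ := fun i => by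
        have hY' := (abs_le.1 (hjunkY i)).1; nlinarith only [hY', hΦr0]
      have := Finset.sum_le_sum fun i (_ : i ∈ Finset.univ) => hterm i
      rw [Finset.sum_const, Finset.card_univ, Fintype.card_fin, nsmul_eq_mul] at this
      have h0 : 0 ≤ (m : ℝ) * M_L := by positivity
      nlinarith only [this, hΦrα, h0]
    -- the help term
    have hbne : b ≠ 0 := by
      intro h0; rw [h0, norm_zero] at hbhalf; linarith only [hbhalf]
    set Bt : E →ₗ[ℝ] E →ₗ[ℝ] ℝ :=
      (ContinuousLinearMap.coeLM ℝ).comp (fderiv ℝ (fderiv ℝ t) x).toLinearMap with hBt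
    have hBtapp : ∀ u w, Bt u w = fderiv ℝ (fderiv ℝ t) x u w := fun u w => rfl
    have hHT := sum_apply_orthonormal_ker_ge hE Bt (C := M₂) (fun u w => by rw [hBtapp]; exact hjunkt u w)
      bH hgne hbne hv hvg
    simp only [hBtapp] at hHT
    -- `‖ĝ - b̂‖ ≤ 6 tα`
    have hgb : ‖‖g‖⁻¹ • g - ‖b‖⁻¹ • b‖ ≤ 6 * tα := by
      have h1' := norm_normalize_sub_normalize_le hgne hbne
      have hgb1 : ‖g - b‖ ≤ 3 / 2 * tα := by
        have e1 : g - b = Φr • a := by rw [hg, hΦt_one, one_smul, add_sub_cancel_right]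
        rw [e1, norm_smul, Real.norm_of_nonneg hΦr0]
        have ha2 : ‖a‖ ≤ 3 / 2 := by
          have := (abs_le.1 h1).2
          nlinarith only [this, norm_nonneg a, hδ]
        nlinarith only [ha2, hΦrα, hΦr0, norm_nonneg a]
      have hbpos : 0 < ‖b‖ := by linarith only [hbhalf]
      calc ‖‖g‖⁻¹ • g - ‖b‖⁻¹ • b‖ ≤ 2 * ‖g - b‖ / ‖b‖ := h1'
        _ ≤ 2 * (3 / 2 * tα) / (1 / 2) := by
            rw [div_le_div_iff₀ hbpos (by norm_num)]
            have htα0 : 0 ≤ tα := hΦr0.trans hΦrα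
            nlinarith only [hgb1, hbhalf, norm_nonneg (g - b), htα0]
        _ = 6 * tα := by ring
    have hJt : H₀ - 12 * M₂ * tα ≤ ∑ i, fderiv ℝ (fderiv ℝ t) x (v i) (v i) := by
      have : 2 * M₂ * ‖‖g‖⁻¹ • g - ‖b‖⁻¹ • b‖ ≤ 2 * M₂ * (6 * tα) :=
        mul_le_mul_of_nonneg_left hgb (by positivity)
      linarith only [hHT, hhelp, this]
    have hsplit : ∑ i, (Φr * ⟪yh, fderiv ℝ (fderiv ℝ Y) x (v i) (v i)⟫ +
        Φt * fderiv ℝ (fderiv ℝ t) x (v i) (v i)) =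
        ∑ i, Φr * ⟪yh, fderiv ℝ (fderiv ℝ Y) x (v i) (v i)⟫ + ∑ i, fderiv ℝ (fderiv ℝ t) x (v i) (v i) := by
      rw [← Finset.sum_add_distrib]
      exact Finset.sum_congr rfl fun i _ => by rw [hΦt_one, one_mul]
    rw [hFS, hsplit]
    linarith only [hSle, herr, hJY, hJt, hQh, hsmall]

end Literature.Geometry.Riemannian



end
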